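import Literature.IUT.LogThetaLattice.GlobalLGPFrobenioidsRealifiedPlacesVsRealifyMod
import Mathlib.Data.Finsupp.Pointwise
import HarnessLib

/-!
# [IUTchIII] Prop. 3.7 (iii)/(iv), [IUTchI] Ex. 3.5 (i) `Φ_{𝒞⊩_mod}`, `ρ_v`: the `e_v`-NORMALISED places dictionary
# of the categorical `(†𝓕⊛ℝ_𝔪𝔬𝔡)_α` — the named repair of finding F-w4d073g4-1 (owner lineage abc-iut-w5-d153, part H′)

S. Mochizuki, *Inter-universal Teichmüller theory III*, Prop. 3.7 (iv) p. 111 ("`†𝔉^⊩_lgp = (†𝒞^⊩_lgp,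
Prime(†𝒞^⊩_lgp) ⥲ V̲, †𝔉^⊢_lgp, {†ρ_{lgp,v}}_{v∈V̲})`") [claim key Mochizuki2012, status disputed (D-0012)];
*Inter-universal Teichmüller theory I*, §3, Example 3.5 (i), kurims manuscript (May 2020) p. 84 ("`Φ_{𝒞⊩_mod,v}` … is
naturally isomorphic to `ord(𝒪^▷_{(F_mod)_v})^pf ⊗ ℝ_{≥0}` … `p_v` determines an element `log⊢_mod(p_v) ∈ Φ_{𝒞⊩_mod,v}`";
"`ρ_v : Φ_{𝒞⊩_mod,v} ⥲ Φ^rlf_{𝒞⊢_v̲}`, `log⊢_mod(p_v) ↦ [K_v̲:(F_mod)_v]⁻¹ · log_Φ(p_v)`"; §0: `ord_v(p_v) = e_v`);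
S. Mochizuki, *The geometry of Frobenioids I*, Kyushu J. Math. **62** (2008), Ex. 6.3 p. 113 (the prime divisor `[v]`
generating `ord(𝒪_v^▷) ≅ ℤ_{≥0}`), Thm. 6.4 (i) p. 115 [cite: MochizukiFrdI2008, Ex. 6.3 p.113].

abc-iut cell, layer L6, wave-5 seat abc-iut-w5-d153 (gen 3): OWNER-LINEAGE REPAIR of the cross-layer normalisation
finding F-w4d073g4-1 (abc-iut-w4-d073 gen 4; kernel certificate `GlobalLGPFrobenioidsRealifiedPlacesVsRealifyMod.lean`,
∃-companion `GlobalLGPFrobenioidsRealifiedPlacesNormalized.lean`), option (a).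

THE FINDING, and the UNITS NOTE for part H (`GlobalLGPFrobenioidsRealifiedPlaces.lean`, immutable).  The divisor monoid
`Φ^ℝ(∗) = effDiv (ModelPlaces F) ℝ` of the categorical realified Frobenioid `Prop37.FrakRlfCat F` carries, at a finite
place `v`, the coordinate "class at `𝔭_v`" in PRIME-DIVISOR units: the realification `realifyEff (effDivOfArith [v])` of the
prime divisor `[v] ∈ Φ(F)` is the family `δ_𝔭` of class `1` (abc-iut-w4-d005, abc-iut-w4-d015).  abc-iut-L5-t2's
`Φ_{𝒞⊩_mod} = InitialThetaData.PhiMod = (V_mod →₀ ℝ_{≥0})` is normalised by "`log⊢_mod(p_v) ↦ 1`"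
(`InitialThetaData.logMod v = single v 1`), and print gives `log⊢_mod(p_v) = ord_v(p_v) · [v] = e_v · [v]`.  Part H's
`effDivAddEquivVal` / `effDivEquivPhiMod` are the PLAIN CLASS REINDEXING `δ_𝔭 ↦ single v 1`: as abstract additive
isomorphisms they are fine, but read in t2's units they name `[v]` as `log⊢_mod(p_v)` — off by the factor `e_v` at every
finite place ramified over `ℚ` (w4-d073's `…_single_inr_ne_realifyMod`); accordingly part H's `rhoLgp D w` (t2's `ρ_w`
precomposed with the `[v]`-unit coordinate) sends `[v] ↦ [K_w:(F_mod)_v]⁻¹ · log_Φ(p_v)` where print's `ρ_v` gives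
`e_v⁻¹ · [K_w:(F_mod)_v]⁻¹ · log_Φ(p_v)`.  The layer-L1/L5 map of record, abc-iut-w4-d050's
`EffArithDivisor.realifyMod` (`[v] ↦ e_v⁻¹ ·` unit vector, `realifyMod_logMod : e_v · [v] ↦ logMod v`), IS print-consistent.

THIS FILE (the repair; data `def`s, no `Prop`-valued definition, no instance), ns `Literature.IUT.LogThetaLattice`:
* complements to t2's `logMod` (`InitialThetaData.logMod_apply_self`, `smul_logMod`, `smul_logMod_apply_self`) and the
  generic coordinate scaling `FinsuppNNReal.scaleAddEquiv c hc : (ι →₀ ℝ_{≥0}) ≃+ (ι →₀ ℝ_{≥0})` by a nowhere-vanishing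
  weight (Mathlib's pointwise module `Finsupp.pointwiseModule`; next to abc-iut-w4-d013's `FinsuppNNReal.primesEquiv`);
* `Prop37.FrakRlfCat.normWeight F : V(F) → ℝ_{≥0}` (`1` at archimedean, `e_v⁻¹` at finite `v`) and
  **`effDivAddEquivValNorm F : Φ^ℝ(∗) ≃+ (V(F) →₀ ℝ_{≥0})`** `:= effDivAddEquivVal F` followed by the scaling — the
  `e_v`-NORMALISED dictionary; `…_apply_inl/_apply_inr` (coordinates), **`…_realifyEff_effDivOfArith`**: along the L6
  route `Φ(F) → Φ(∗) → Φ^ℝ(∗)` it IS `realifyMod F` on ALL of `Φ(F)` (so it is the layer-L1/L5 identification of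
  record), `eq_effDivAddEquivValNorm` (it is THE additive isomorphism with w4-d073's two coordinate properties — his
  ∃-witness of `exists_effDivAddEquivVal_normalized_realifyMod` is this map), `…_delta` (`δ_𝔭 ↦ single v (e_v⁻¹)` at
  finite `v`, `single v 1` at archimedean `v`), `…_symm_single_inr_one` (t2's unit `single v 1 = log⊢_mod(p_v)` pulls back
  to the realified divisor `div_v(p_v) = ord_v(p_v)·[v]` of layer L1's model);
* at the field of moduli of an initial Θ-datum `D` ([IUTchI] Def. 3.1, abc-iut-L5-t2): **`effDivEquivPhiModNorm D :
  Φ^ℝ(∗)(F_mod) ≃+ D.PhiMod = Φ_{𝒞⊩_mod}`** (and `effDivEquivPhiFrakRlfNorm D j` into abc-iut-w4-d013's `PhiFrakRlf D j`)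
  with `…_realifyEff_effDivOfArith` (`= realifyMod`), **`…_logDivisor`** (`div_v(p_v) = e_v·[v] ↦ logMod v` — [IUTchI]
  Ex. 3.5 (i) "`p_v` determines `log⊢_mod(p_v)`" in t2's convention), `…_primeDivisor` (`[v] ↦ e_v⁻¹ • logMod v`),
  `…_logDivisor_arch`, `…_symm_logMod`, `…_apply_inr / _apply_inl` (relation to part H's `effDivEquivPhiMod`: equal at
  archimedean, `e_v⁻¹ ·` at finite coordinates);
* **`rhoLgpNorm D w`** — print's `†ρ_{lgp,v}` for the categorical Frobenioid in t2's units: `ρ_w` (`InitialThetaData.rho`)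
  precomposed with the NORMALISED `v`-coordinate at `v = toVMod w`; `rhoLgpNorm_ofAdd`, the relation to part H's `rhoLgp`
  (`…_eq_rhoLgp_of_toVMod_eq_inl`, `…_eq_inv_mul_rhoLgp_of_toVMod_eq_inr`), and the PRINT DISPLAY
  **`rhoLgpNorm_logDivisor`**: on the realified divisor `div_v(p_v) = e_v·[v]` the value is `D.rhoScalar w = [K_w:(F_mod)_v]⁻¹`
  (in t2's units `log_Φ(p_v) ↦ 1`) — "`log⊢_mod(p_v) ↦ [K_v̲:(F_mod)_v]⁻¹ · log_Φ(p_v)`" exactly; `rhoLgpNorm_primeDivisor`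
  (`[v] ↦ e_v⁻¹ · [K_w:(F_mod)_v]⁻¹`), `rhoLgpNorm_symm_logMod`.
The primes dictionary needs no repair (scalings do not move primes): `primesEquivVal F` is also the transport of
`FinsuppNNReal.primesEquiv` along the normalised map — proved in the PROOF-ONLY companion `…NormalizedProofs.lean`.
Consumers composing the categorical `(†𝓕⊛ℝ_𝔪𝔬𝔡)_α` with abc-iut-L5-t2's `logMod` / `ρ_v` scalars should use the `…Norm`
declarations.  Nothing of part H is touched (append-only tree); no new Prop fact; no statement of the paper is strengthened;
nothing here asserts a disputed claim or takes a side on [IUTchIII] Cor. 3.12; typed ≠ discharged; instantiated ≠ endorsed.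
-/

noncomputable section

/-! ### Complements to abc-iut-L5-t2's `logMod` (evaluation lemmas, stated over `Val` so that they rewrite at use sites) -/

namespace Literature.IUT.HodgeTheaters.InitialThetaData

open scoped NNReal

variable {F K Fbar : Type*} [Field F] [NumberField F] [Field K] [NumberField K] [Algebra F K] [Field Fbar]
  [Algebra F Fbar] [Algebra K Fbar] {E : WeierstrassCurve F} [E.IsElliptic] {l : ℕ} {P : BadPlacePredicates K}
  (D : InitialThetaData F K Fbar E l P)

/-- `log⊢_mod(p_v)` has `v`-coordinate `1` (abc-iut-L5-t2's convention). ([IUTchI] Ex 3.5 (i) p.84)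
[claim: Mochizuki2012, status: disputed] -/
theorem logMod_apply_self (q : Val (fieldOfModuli E)) : D.logMod q q = 1 :=
  Finsupp.single_eq_same

/-- `c • log⊢_mod(p_v)` is the vector with `v`-coordinate `c` and no other. ([IUTchI] Ex 3.5 (i) p.84)
[claim: Mochizuki2012, status: disputed] -/
theorem smul_logMod (c : ℝ≥0) (q : Val (fieldOfModuli E)) :
    c • D.logMod q = Finsupp.single (α := Val (fieldOfModuli E)) q c := by
  rw [InitialThetaData.logMod, Finsupp.smul_single, smul_eq_mul, mul_one]

/-- `c • log⊢_mod(p_v)` has `v`-coordinate `c`. ([IUTchI] Ex 3.5 (i) p.84) [claim: Mochizuki2012, status: disputed] -/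
theorem smul_logMod_apply_self (c : ℝ≥0) (q : Val (fieldOfModuli E)) : (c • D.logMod q) q = c := by
  rw [smul_logMod, Finsupp.single_eq_same]

end Literature.IUT.HodgeTheaters.InitialThetaData

namespace Literature.IUT.LogThetaLattice

open NumberField IsDedekindDomain GlobalFrobenioidModels Literature.AlgebraicGeometry.Frobenioids
  Literature.IUT.HodgeTheaters
open scoped NNReal

/-! ### Generic: coordinate scalings of a free `ℝ_{≥0}`-module and their effect on primes -/

namespace FinsuppNNReal

variable {ι : Type*}

/-- **Coordinate scaling** `f ↦ (i ↦ c_i · f_i)` of finitely supported `ℝ_{≥0}`-valued functions by a nowhere-vanishing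
weight `c`, as an additive isomorphism (Mathlib's pointwise action `Finsupp.pointwiseModule` of `ι → ℝ_{≥0}` on
`ι →₀ ℝ_{≥0}`; inverse = scaling by `c⁻¹`) — the change of generators of the free `ℝ_{≥0}`-module `M ⊗ ℝ_{≥0}` of
[FrdI] §0 ("`M^pf ⊗ ℝ_{≥0}`"). [cite: MochizukiFrdI2008, §0 p.12] -/
def scaleAddEquiv (c : ι → ℝ≥0) (hc : ∀ i, c i ≠ 0) : (ι →₀ ℝ≥0) ≃+ (ι →₀ ℝ≥0) where
  toFun f := c • f
  invFun f := c⁻¹ • f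
  left_inv f := Finsupp.ext fun i => inv_mul_cancel_left₀ (hc i) (f i)
  right_inv f := Finsupp.ext fun i => mul_inv_cancel_left₀ (hc i) (f i)
  map_add' f g := smul_add c f g

/-- `scaleAddEquiv c hc f i = c_i · f_i`. [cite: MochizukiFrdI2008, §0 p.12] -/
@[simp] theorem scaleAddEquiv_apply (c : ι → ℝ≥0) (hc : ∀ i, c i ≠ 0) (f : ι →₀ ℝ≥0) (i : ι) :
    scaleAddEquiv c hc f i = c i * f i := rfl

/-- `(scaleAddEquiv c hc)⁻¹ f i = c_i⁻¹ · f_i`. [cite: MochizukiFrdI2008, §0 p.12] -/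
@[simp] theorem scaleAddEquiv_symm_apply (c : ι → ℝ≥0) (hc : ∀ i, c i ≠ 0) (f : ι →₀ ℝ≥0) (i : ι) :
    (scaleAddEquiv c hc).symm f i = (c i)⁻¹ * f i := rfl

/-- A scaling sends the unit vector `single i x` to `single i (c_i · x)`. [cite: MochizukiFrdI2008, §0 p.12] -/
theorem scaleAddEquiv_single (c : ι → ℝ≥0) (hc : ∀ i, c i ≠ 0) (i : ι) (x : ℝ≥0) :
    scaleAddEquiv c hc (Finsupp.single i x) = Finsupp.single i (c i * x) := by
  classical
  refine Finsupp.ext fun j => ?_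
  rw [scaleAddEquiv_apply, Finsupp.single_apply, Finsupp.single_apply]
  split_ifs with h
  · subst h; rfl
  · exact mul_zero _

end FinsuppNNReal

namespace Prop37

namespace FrakRlfCat

variable (F : Type) [Field F] [NumberField F]

/-! ### The `e_v`-normalising weights on `V(F)` -/

/-- The normalising weight at a place of `F`: `1` at an archimedean place, `e_v⁻¹` (inverse absolute ramification index,
abc-iut-w4-d050's `absRamIdx`; `ord_v(p_v) = e_v`) at a finite place — the passage from prime-divisor units `[v] ↦ 1` to
abc-iut-L5-t2's units `log⊢_mod(p_v) = e_v·[v] ↦ 1`. ([IUTchI] Ex 3.5 (i) p.84) [claim: Mochizuki2012, status: disputed] -/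
def normWeight : Val F → ℝ≥0 := fun q =>
  match q with
  | Sum.inl _ => 1
  | Sum.inr v => (absRamIdx F v : ℝ≥0)⁻¹

/-- `normWeight` at an archimedean place is `1`. ([IUTchI] Ex 3.5 (i) p.84) [claim: Mochizuki2012, status: disputed] -/
@[simp] theorem normWeight_inl (w : InfinitePlace F) : normWeight F (Sum.inl w) = 1 := rfl

/-- `normWeight` at a finite place is `e_v⁻¹`. ([IUTchI] Ex 3.5 (i) p.84) [claim: Mochizuki2012, status: disputed] -/
@[simp] theorem normWeight_inr (v : FinitePlace F) : normWeight F (Sum.inr v) = (absRamIdx F v : ℝ≥0)⁻¹ := rfl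

/-- The normalising weights are nowhere zero (`e_v ≥ 1`). ([IUTchI] Ex 3.5 (i) p.84) [claim: Mochizuki2012, status: disputed] -/
theorem normWeight_ne_zero (q : Val F) : normWeight F q ≠ 0 := by
  rcases q with w | v
  · exact one_ne_zero
  · exact inv_ne_zero (absRamIdx_cast_ne_zero F v)

/-! ### The normalised dictionary `Φ^ℝ(∗) ≃+ (V(F) →₀ ℝ_{≥0})` -/

/-- **`Φ^ℝ(∗) ≃+ (V(F) →₀ ℝ_{≥0})`, `e_v`-NORMALISED**: part H's class reindexing `effDivAddEquivVal F` followed by the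
coordinate scaling `x_v ↦ e_v⁻¹ · x_v` at the finite places (identity at the archimedean ones) — the divisor monoid of the
categorical realified Frobenioid `(†𝓕⊛ℝ_𝔪𝔬𝔡)_α` in [IUTchI] Ex. 3.5 (i)'s coordinates WITH abc-iut-L5-t2's unit
`log⊢_mod(p_v) ↦ 1`. ([IUTchI] Ex 3.5 (i) p.84; [FrdI] Thm 6.4 (i) p.115) [claim: Mochizuki2012, status: disputed] -/
def effDivAddEquivValNorm : effDiv (ModelPlaces F) (fun _ => ℝ) nonnegModel ≃+ (Val F →₀ ℝ≥0) :=
  (effDivAddEquivVal F).trans (FinsuppNNReal.scaleAddEquiv (normWeight F) (normWeight_ne_zero F))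

/-- Coordinates of the normalised dictionary: the weight times part H's coordinate.
([IUTchI] Ex 3.5 (i) p.84) [claim: Mochizuki2012, status: disputed] -/
theorem effDivAddEquivValNorm_apply (D : effDiv (ModelPlaces F) (fun _ => ℝ) nonnegModel) (q : Val F) :
    effDivAddEquivValNorm F D q = normWeight F q * effDivAddEquivVal F D q := rfl

/-- At an archimedean place the normalised dictionary IS part H's (`x_v`).
([IUTchI] Ex 3.5 (i) p.84) [claim: Mochizuki2012, status: disputed] -/
theorem effDivAddEquivValNorm_apply_inl (D : effDiv (ModelPlaces F) (fun _ => ℝ) nonnegModel) (w : InfinitePlace F) :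
    effDivAddEquivValNorm F D (Sum.inl w) = effDivAddEquivVal F D (Sum.inl w) :=
  one_mul _

/-- At a finite place the normalised coordinate is `e_v⁻¹ ·` part H's (the class at `𝔭_v` divided by `ord_v(p_v)`).
([IUTchI] Ex 3.5 (i) p.84) [claim: Mochizuki2012, status: disputed] -/
theorem effDivAddEquivValNorm_apply_inr (D : effDiv (ModelPlaces F) (fun _ => ℝ) nonnegModel) (v : FinitePlace F) :
    effDivAddEquivValNorm F D (Sum.inr v) = (absRamIdx F v : ℝ≥0)⁻¹ * effDivAddEquivVal F D (Sum.inr v) := rfl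

/-- **Along the L6 route `Φ(F) → Φ(∗) → Φ^ℝ(∗)` the normalised dictionary IS the layer-L1/L5 realification map
`realifyMod`** (abc-iut-w4-d050) — on ALL of `Φ(F)`, not only on prime divisors: the two cell identifications of
`Φ_{𝒞⊩_mod}` now coincide. ([IUTchI] Ex 3.5 (i) p.84) [claim: Mochizuki2012, status: disputed] -/
theorem effDivAddEquivValNorm_realifyEff_effDivOfArith (a : EffArithDivisor F) :
    effDivAddEquivValNorm F (realifyEff F (effDivOfArith F a)) = EffArithDivisor.realifyMod F a := by
  refine Finsupp.ext fun q => ?_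
  rcases q with w | v
  · rw [effDivAddEquivValNorm_apply_inl, effDivAddEquivVal_realifyEff_effDivOfArith_apply_inl_eq_realifyMod]
  · rw [effDivAddEquivValNorm_apply_inr, effDivAddEquivVal_realifyEff_effDivOfArith_apply_inr, realifyMod_apply_inr,
      mul_comm]

/-- **Characterisation**: an additive isomorphism `Φ^ℝ(∗) ≃+ (V(F) →₀ ℝ_{≥0})` whose archimedean coordinates are part H's and
whose finite coordinates are `e_v⁻¹ ·` part H's IS `effDivAddEquivValNorm` — in particular abc-iut-w4-d073's ∃-witness of
`exists_effDivAddEquivVal_normalized_realifyMod` is this map. ([IUTchI] Ex 3.5 (i) p.84) [claim: Mochizuki2012, status: disputed] -/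
theorem eq_effDivAddEquivValNorm {Θ : effDiv (ModelPlaces F) (fun _ => ℝ) nonnegModel ≃+ (Val F →₀ ℝ≥0)}
    (hinl : ∀ (D : effDiv (ModelPlaces F) (fun _ => ℝ) nonnegModel) (w : InfinitePlace F),
      Θ D (Sum.inl w : Val F) = effDivAddEquivVal F D (Sum.inl w : Val F))
    (hinr : ∀ (D : effDiv (ModelPlaces F) (fun _ => ℝ) nonnegModel) (v : FinitePlace F),
      Θ D (Sum.inr v : Val F) = (absRamIdx F v : ℝ≥0)⁻¹ * effDivAddEquivVal F D (Sum.inr v : Val F)) :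
    Θ = effDivAddEquivValNorm F := by
  refine AddEquiv.ext fun D => Finsupp.ext fun q => ?_
  rcases q with w | v
  · rw [hinl, effDivAddEquivValNorm_apply_inl]
  · rw [hinr, effDivAddEquivValNorm_apply_inr]

/-- **`δ_𝔭 ↦ single v (weight)`**: the class-`1` family at the model place `p` (the realified PRIME DIVISOR `[v]`, resp.
the archimedean unit) goes to `e_v⁻¹ ·` (resp. `1 ·`) the unit vector at the place `v` of `p`.
([IUTchI] Ex 3.5 (i) p.84; [FrdI] §0 p.12) [claim: Mochizuki2012, status: disputed] -/
theorem effDivAddEquivValNorm_delta (p : ModelPlaces F) :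
    effDivAddEquivValNorm F (delta F p) =
      Finsupp.single (modelPlacesEquivVal F p) (normWeight F (modelPlacesEquivVal F p)) := by
  show FinsuppNNReal.scaleAddEquiv (normWeight F) (normWeight_ne_zero F) (effDivAddEquivVal F (delta F p)) = _
  rw [effDivAddEquivVal_delta, FinsuppNNReal.scaleAddEquiv_single, mul_one]

/-- `δ_𝔭` for a maximal ideal `𝔭`: the realified prime divisor `[v]` goes to `e_v⁻¹ · logMod`-unit at the finite place `v`
of `𝔭` (`[v] = e_v⁻¹ · log⊢_mod(p_v)`). ([IUTchI] Ex 3.5 (i) p.84) [claim: Mochizuki2012, status: disputed] -/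
theorem effDivAddEquivValNorm_delta_inl (v : HeightOneSpectrum (𝓞 F)) :
    effDivAddEquivValNorm F (delta F (Sum.inl v)) =
      Finsupp.single (α := Val F) (Sum.inr (FinitePlace.mk v)) ((absRamIdx F (FinitePlace.mk v) : ℝ≥0)⁻¹) := by
  rw [effDivAddEquivValNorm_delta, modelPlacesEquivVal_inl]
  rfl

/-- `δ_𝔭` for an archimedean place: the unit vector there (no rescaling). ([IUTchI] Ex 3.5 (i) p.84)
[claim: Mochizuki2012, status: disputed] -/
theorem effDivAddEquivValNorm_delta_inr (w : InfinitePlace F) :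
    effDivAddEquivValNorm F (delta F (Sum.inr w)) = Finsupp.single (α := Val F) (Sum.inl w) 1 := by
  rw [effDivAddEquivValNorm_delta, modelPlacesEquivVal_inr]
  rfl

/-- **`log⊢_mod(p_v) = div_v(p_v) = ord_v(p_v) · [v]`**: under the inverse dictionary the unit vector at a finite place `v`
(abc-iut-L5-t2's `log⊢_mod(p_v)`) is the realification of the arithmetic divisor `e_v · [v] ∈ Φ(F)` of layer L1's model
(abc-iut-w4-d050's `realifyMod_single_absRamIdx`). ([IUTchI] Ex 3.5 (i) p.84) [claim: Mochizuki2012, status: disputed] -/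
theorem effDivAddEquivValNorm_symm_single_inr_one (v : FinitePlace F) :
    (effDivAddEquivValNorm F).symm (Finsupp.single (α := Val F) (Sum.inr v) 1) =
      realifyEff F (effDivOfArith F (((Finsupp.single v (absRamIdx F v), 0) : EffArithDivisor F))) :=
  (effDivAddEquivValNorm F).injective (by
    rw [AddEquiv.apply_symm_apply, effDivAddEquivValNorm_realifyEff_effDivOfArith, realifyMod_single_absRamIdx])

/-! ### At an initial Θ-datum: `Φ^ℝ(∗)(F_mod) = Φ_{𝒞⊩_mod}` in abc-iut-L5-t2's units, and `†ρ_{lgp,v}` -/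

section InitialTheta

variable {F₀ K Fbar : Type} [Field F₀] [NumberField F₀] [Field K] [NumberField K] [Algebra F₀ K] [Field Fbar]
  [Algebra F₀ Fbar] [Algebra K Fbar] {E : WeierstrassCurve F₀} [E.IsElliptic] {l : ℕ} {P : BadPlacePredicates K}
  (D : InitialThetaData F₀ K Fbar E l P)

/-- **The divisor monoid of the categorical `(†𝓕⊛ℝ_𝔪𝔬𝔡)_α` at the field of moduli IS `Φ_{𝒞⊩_mod}`, in abc-iut-L5-t2's
units `log⊢_mod(p_v) ↦ 1`** — the `e_v`-normalised dictionary at `F_mod` (the repair of part H's `effDivEquivPhiMod`).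
([IUTchI] Ex 3.5 (i) p.84; [IUTchIII] Prop 3.7 (iii) p.110) [claim: Mochizuki2012, status: disputed] -/
def effDivEquivPhiModNorm : effDiv (ModelPlaces (fieldOfModuli E)) (fun _ => ℝ) nonnegModel ≃+ D.PhiMod :=
  effDivAddEquivValNorm (fieldOfModuli E)

/-- … and in abc-iut-w4-d013's divisor-level `(†𝓕⊛ℝ_𝔪𝔬𝔡)_j` (every label `j`; `PhiFrakRlf D j := D.PhiMod`).
([IUTchIII] Prop 3.7 (iii) p.110) [claim: Mochizuki2012, status: disputed] -/
def effDivEquivPhiFrakRlfNorm (j : Fin (lStar l)) :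
    effDiv (ModelPlaces (fieldOfModuli E)) (fun _ => ℝ) nonnegModel ≃+ PhiFrakRlf D j :=
  effDivEquivPhiModNorm D

/-- Along the L6 route the normalised dictionary at `F_mod` IS `realifyMod` (abc-iut-w4-d050).
([IUTchI] Ex 3.5 (i) p.84) [claim: Mochizuki2012, status: disputed] -/
theorem effDivEquivPhiModNorm_realifyEff_effDivOfArith (a : EffArithDivisor (fieldOfModuli E)) :
    effDivEquivPhiModNorm D (realifyEff (fieldOfModuli E) (effDivOfArith (fieldOfModuli E) a)) =
      EffArithDivisor.realifyMod (fieldOfModuli E) a :=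
  effDivAddEquivValNorm_realifyEff_effDivOfArith (fieldOfModuli E) a

/-- **[IUTchI] Ex. 3.5 (i) "`p_v` determines an element `log⊢_mod(p_v) ∈ Φ_{𝒞⊩_mod,v}`"**: the realified `v`-component
`div_v(p_v) = ord_v(p_v) · [v] = e_v · [v]` of the divisor of `p_v` goes to abc-iut-L5-t2's `logMod v` (via
abc-iut-w4-d050's `realifyMod_logMod`). ([IUTchI] Ex 3.5 (i) p.84) [claim: Mochizuki2012, status: disputed] -/
theorem effDivEquivPhiModNorm_logDivisor (v : FinitePlace (fieldOfModuli E)) :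
    effDivEquivPhiModNorm D (realifyEff (fieldOfModuli E) (effDivOfArith (fieldOfModuli E)
        ((Finsupp.single v (absRamIdx (fieldOfModuli E) v), 0) : EffArithDivisor (fieldOfModuli E)))) =
      D.logMod (Sum.inr v) := by
  rw [effDivEquivPhiModNorm_realifyEff_effDivOfArith]
  exact realifyMod_logMod D v

/-- The realified PRIME DIVISOR `[v]` goes to `e_v⁻¹ • logMod v` (`[v] = ord_v(p_v)⁻¹ · log⊢_mod(p_v)`).
([IUTchI] Ex 3.5 (i) p.84) [claim: Mochizuki2012, status: disputed] -/
theorem effDivEquivPhiModNorm_primeDivisor (v : FinitePlace (fieldOfModuli E)) :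
    effDivEquivPhiModNorm D (realifyEff (fieldOfModuli E) (effDivOfArith (fieldOfModuli E)
        ((Finsupp.single v 1, 0) : EffArithDivisor (fieldOfModuli E)))) =
      (absRamIdx (fieldOfModuli E) v : ℝ≥0)⁻¹ • D.logMod (Sum.inr v) := by
  rw [effDivEquivPhiModNorm_realifyEff_effDivOfArith, realifyMod_single_inr, D.smul_logMod _ (Sum.inr v)]

open scoped Classical in
/-- At an archimedean place `v` of `F_mod` the unit archimedean divisor goes to `logMod v` (both conventions have
`log(p_v) = 1` there; abc-iut-w4-d050's `realifyMod_logMod_arch`). ([IUTchI] Ex 3.5 (i) p.84) [claim: Mochizuki2012, status: disputed] -/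
theorem effDivEquivPhiModNorm_logDivisor_arch (v : InfinitePlace (fieldOfModuli E)) :
    effDivEquivPhiModNorm D (realifyEff (fieldOfModuli E) (effDivOfArith (fieldOfModuli E)
        ((0, Pi.single v 1) : EffArithDivisor (fieldOfModuli E)))) =
      D.logMod (Sum.inl v) := by
  rw [effDivEquivPhiModNorm_realifyEff_effDivOfArith]
  exact realifyMod_logMod_arch D v

/-- **abc-iut-L5-t2's `log⊢_mod(p_v)` IS the realified divisor `div_v(p_v) = ord_v(p_v) · [v]` of layer L1's model** under
the inverse dictionary. ([IUTchI] Ex 3.5 (i) p.84) [claim: Mochizuki2012, status: disputed] -/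
theorem effDivEquivPhiModNorm_symm_logMod (v : FinitePlace (fieldOfModuli E)) :
    (effDivEquivPhiModNorm D).symm (D.logMod (Sum.inr v)) =
      realifyEff (fieldOfModuli E) (effDivOfArith (fieldOfModuli E)
        ((Finsupp.single v (absRamIdx (fieldOfModuli E) v), 0) : EffArithDivisor (fieldOfModuli E))) :=
  (effDivEquivPhiModNorm D).injective (by rw [AddEquiv.apply_symm_apply, effDivEquivPhiModNorm_logDivisor])

/-- Relation to part H at a finite coordinate: `effDivEquivPhiModNorm = e_v⁻¹ · effDivEquivPhiMod`.
([IUTchI] Ex 3.5 (i) p.84) [claim: Mochizuki2012, status: disputed] -/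
theorem effDivEquivPhiModNorm_apply_inr (Dv : effDiv (ModelPlaces (fieldOfModuli E)) (fun _ => ℝ) nonnegModel)
    (v : FinitePlace (fieldOfModuli E)) :
    effDivEquivPhiModNorm D Dv (Sum.inr v) = (absRamIdx (fieldOfModuli E) v : ℝ≥0)⁻¹ * effDivEquivPhiMod D Dv (Sum.inr v) :=
  rfl

/-- Relation to part H at an archimedean coordinate: equal. ([IUTchI] Ex 3.5 (i) p.84) [claim: Mochizuki2012, status: disputed] -/
theorem effDivEquivPhiModNorm_apply_inl (Dv : effDiv (ModelPlaces (fieldOfModuli E)) (fun _ => ℝ) nonnegModel)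
    (w : InfinitePlace (fieldOfModuli E)) :
    effDivEquivPhiModNorm D Dv (Sum.inl w) = effDivEquivPhiMod D Dv (Sum.inl w) :=
  one_mul _

/-- **`†ρ_{lgp,v}` for the categorical realified Frobenioid, in abc-iut-L5-t2's units** ([IUTchIII] Prop. 3.7 (iv);
[IUTchI] Ex. 3.5 (i) "`ρ_v : Φ_{𝒞^⊩_mod,v} ⥲ Φ^rlf_{𝒞^⊢_v̲}`"): t2's `ρ_v̲ = InitialThetaData.rho w` precomposed with the
NORMALISED `v`-coordinate of `Φ^ℝ(∗)(F_mod)` at the place `v = toVMod w ∈ V_mod` below `w = v̲ ∈ V(K)` — the repair of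
part H's `rhoLgp` (which reads the `[v]`-unit coordinate). Multiplicative rendering as in part D.
([IUTchIII] Prop 3.7 (iv) p.111; [IUTchI] Ex 3.5 (i) p.84) [claim: Mochizuki2012, status: disputed] -/
def rhoLgpNorm (w : Val K) :
    EffDiv (ModelPlaces (fieldOfModuli E)) (fun _ => ℝ) nonnegModel →* Multiplicative (D.PhiDashRlf w) :=
  AddMonoidHom.toMultiplicative
    ((D.rho w).comp ((Finsupp.applyAddHom (toVMod F₀ K E w)).comp (effDivEquivPhiModNorm D).toAddMonoidHom))

/-- `†ρ_{lgp,v}` (normalised) on an effective real family: `ρ_w` of its normalised coordinate at `toVMod w`.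
([IUTchI] Ex 3.5 (i) p.84) [claim: Mochizuki2012, status: disputed] -/
theorem rhoLgpNorm_ofAdd (w : Val K) (Dv : effDiv (ModelPlaces (fieldOfModuli E)) (fun _ => ℝ) nonnegModel) :
    Multiplicative.toAdd (rhoLgpNorm D w (Multiplicative.ofAdd Dv)) =
      D.rho w (effDivEquivPhiModNorm D Dv (toVMod F₀ K E w)) :=
  rfl

/-- Over an ARCHIMEDEAN place of `F_mod` the normalised `†ρ_{lgp,v}` IS part H's `rhoLgp`.
([IUTchI] Ex 3.5 (i) p.84) [claim: Mochizuki2012, status: disputed] -/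
theorem rhoLgpNorm_eq_rhoLgp_of_toVMod_eq_inl {w : Val K} {v : InfinitePlace (fieldOfModuli E)}
    (hv : toVMod F₀ K E w = Sum.inl v) (X : EffDiv (ModelPlaces (fieldOfModuli E)) (fun _ => ℝ) nonnegModel) :
    rhoLgpNorm D w X = rhoLgp D w X := by
  apply Multiplicative.toAdd.injective
  rw [← ofAdd_toAdd X, rhoLgpNorm_ofAdd, rhoLgp_ofAdd, hv, effDivEquivPhiModNorm_apply_inl]

/-- Over a FINITE place `v` of `F_mod` the normalised `†ρ_{lgp,v}` is `e_v⁻¹ ·` part H's `rhoLgp` (`ρ_w` is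
`ℝ_{≥0}`-linear). ([IUTchI] Ex 3.5 (i) p.84) [claim: Mochizuki2012, status: disputed] -/
theorem rhoLgpNorm_eq_inv_mul_rhoLgp_of_toVMod_eq_inr {w : Val K} {v : FinitePlace (fieldOfModuli E)}
    (hv : toVMod F₀ K E w = Sum.inr v) (X : EffDiv (ModelPlaces (fieldOfModuli E)) (fun _ => ℝ) nonnegModel) :
    Multiplicative.toAdd (rhoLgpNorm D w X) =
      (absRamIdx (fieldOfModuli E) v : ℝ≥0)⁻¹ * Multiplicative.toAdd (rhoLgp D w X) := by
  rw [← ofAdd_toAdd X, rhoLgpNorm_ofAdd, rhoLgp_ofAdd, hv, effDivEquivPhiModNorm_apply_inr]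
  show D.rhoScalar w * _ = _ * (D.rhoScalar w * _)
  rw [mul_left_comm]

/-- **PRINT DISPLAY of [IUTchI] Ex. 3.5 (i), "`ρ_v : log⊢_mod(p_v) ↦ [K_v̲:(F_mod)_v]⁻¹ · log_Φ(p_v)`", for the categorical
`(†𝓕⊛ℝ_𝔪𝔬𝔡)_α`**: the normalised `†ρ_{lgp,v}` sends the realified divisor `div_v(p_v) = e_v · [v]` (`v = toVMod w` finite)
to abc-iut-L5-t2's scalar `rhoScalar w = [K_w:(F_mod)_v]⁻¹` (in t2's units `log_Φ(p_v) ↦ 1` of `Φ^rlf_{𝒞⊢_v̲}`).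
([IUTchI] Ex 3.5 (i) p.84) [claim: Mochizuki2012, status: disputed] -/
theorem rhoLgpNorm_logDivisor {w : Val K} {v : FinitePlace (fieldOfModuli E)} (hv : toVMod F₀ K E w = Sum.inr v) :
    Multiplicative.toAdd (rhoLgpNorm D w (Multiplicative.ofAdd
      (realifyEff (fieldOfModuli E) (effDivOfArith (fieldOfModuli E)
        ((Finsupp.single v (absRamIdx (fieldOfModuli E) v), 0) : EffArithDivisor (fieldOfModuli E)))))) =
      D.rhoScalar w := by
  rw [rhoLgpNorm_ofAdd, effDivEquivPhiModNorm_logDivisor, hv]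
  show D.rhoScalar w * D.logMod (Sum.inr v) (Sum.inr v) = _
  rw [D.logMod_apply_self (Sum.inr v), mul_one]

/-- … and the realified PRIME DIVISOR `[v]` goes to `e_v⁻¹ · [K_w:(F_mod)_v]⁻¹` (`· log_Φ(p_v)`), as print's `ρ_v`
prescribes for `[v] = ord_v(p_v)⁻¹ · log⊢_mod(p_v)`. ([IUTchI] Ex 3.5 (i) p.84) [claim: Mochizuki2012, status: disputed] -/
theorem rhoLgpNorm_primeDivisor {w : Val K} {v : FinitePlace (fieldOfModuli E)} (hv : toVMod F₀ K E w = Sum.inr v) :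
    Multiplicative.toAdd (rhoLgpNorm D w (Multiplicative.ofAdd
      (realifyEff (fieldOfModuli E) (effDivOfArith (fieldOfModuli E)
        ((Finsupp.single v 1, 0) : EffArithDivisor (fieldOfModuli E)))))) =
      (absRamIdx (fieldOfModuli E) v : ℝ≥0)⁻¹ * D.rhoScalar w := by
  rw [rhoLgpNorm_ofAdd, effDivEquivPhiModNorm_primeDivisor, hv]
  show D.rhoScalar w * ((absRamIdx (fieldOfModuli E) v : ℝ≥0)⁻¹ • D.logMod (Sum.inr v)) (Sum.inr v) = _
  rw [D.smul_logMod_apply_self _ (Sum.inr v), mul_comm]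

/-- `†ρ_{lgp,v}` (normalised) on t2's `log⊢_mod(p_v)` pulled back to `Φ^ℝ(∗)`: the scalar `[K_w:(F_mod)_v]⁻¹` — the display
of `ρ_v` read directly in `Φ_{𝒞⊩_mod}`-coordinates. ([IUTchI] Ex 3.5 (i) p.84) [claim: Mochizuki2012, status: disputed] -/
theorem rhoLgpNorm_symm_logMod (w : Val K) :
    Multiplicative.toAdd (rhoLgpNorm D w (Multiplicative.ofAdd
      ((effDivEquivPhiModNorm D).symm (D.logMod (toVMod F₀ K E w))))) = D.rhoScalar w := by
  rw [rhoLgpNorm_ofAdd, AddEquiv.apply_symm_apply]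
  show D.rhoScalar w * D.logMod (toVMod F₀ K E w) (toVMod F₀ K E w) = _
  rw [D.logMod_apply_self, mul_one]

end InitialTheta

end FrakRlfCat

end Prop37

end Literature.IUT.LogThetaLattice

end
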